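import Summits.SmoothPoincare4.SmoothPoincare4.Theorems.SblfDescentRungOneHelperBottFlowTube
import HarnessLib

/-!
# The global tube parametrisation of a Morse–Bott superlevel set (flow layer, part 3)

Helper `helper_bott_flow` of stub `helper_sliceGluing_bottRecognition` (fibred Morse–Bott
recognition of the polar tube), line `Sketch`, crux `SblfDescent.RungOne`; part 3 of 3
(`SblfDescentRungOneHelperBottFlowODE.lean`, `SblfDescentRungOneHelperBottFlowTube.lean`).

(Crux item stmt-SmoothPoincare4-18531; skeleton `Cruxes/RungOne/Lines/Sketch.lean`.)

In the setting `BottFlow.Setup` of part 2 (a closed `4`-manifold `X`, `F`, `β`, levels `a < b`,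
the maximum circle `e`, a Morse–Bott tube `ν`, a field `W` with `W(F) = 2 (F - b)`, `W(β) = 0`
on `{a ≤ F}` and its flow `θ`), part 2 built the smooth global tube
`Ν (u, y) = θ (½ log λ(‖y‖²), ν (u, y / √λ(‖y‖²)))` with `F (Ν (u, y)) = b - ‖y‖²`,
`β (Ν (u, y)) = u` (`‖y‖ ≤ √(b - a)`).  Here:

* `BottFlow.Setup.Νinv` — the inverse `x ↦ (u, √λ(b - F x) • y')` where
  `(u, y') = ν⁻¹ (θ (-½ log λ(b - F x), x))`: a left inverse of `Ν` on `𝕊¹ × D³(√(b - a))`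
  (`Νinv_Ν`), smooth at every point of `{a ≤ F}` (`contMDiffAt_Νinv`: the flowed-back point lies
  in the open tube, where `ν⁻¹` is smooth by the inverse function theorem,
  `Literature.Geometry.Manifold.contMDiffOn_invFunOn_of_bijective_mfderiv`);
* `BottFlow.Setup.exists_Ν_eq` — every point of `{a ≤ F}` is `Ν (u, y)` with `‖y‖ ≤ √(b - a)`
  (flow back into the tube: off the tube `F ≤ m < b` by compactness);
* `helper_bott_flow` — the registered statement: the existence of such `Ν`, `Νinv`.

With the model layer `helper_bott_model` this identifies `{a ≤ F}` with the polar tube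
`S¹ × D³ ⊆ S⁴`, the fibred (`β`-preserving) form of Milnor's regular interval theorem glued to the
Morse–Bott lemma along the maximum circle.

## References

* J. Milnor, *Morse theory*, Ann. of Math. Studies 51 (1963), Thm. 3.1. [Milnor1963]
* J. M. Lee, *Introduction to Smooth Manifolds*, 2nd ed. (2012), Thm. 9.12, Thm. 4.5. [LeeSmoothManifolds2013]
-/

set_option linter.dupNamespace false

noncomputable section

open scoped Manifold ContDiff Topology
open Set Function Filter Metric Literature.Topology.FourManifolds

namespace Summit.SmoothPoincare4.SmoothPoincare4.Cruxes.RungOne.Sketch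

namespace BottFlow

namespace Setup

variable {X : Type} [TopologicalSpace X] [ChartedSpace (EuclideanSpace ℝ (Fin 4)) X]
  [IsManifold (𝓡 4) ∞ X] (D : Setup X)

/-! ### The inverse of the tube `ν` -/

/-- A point of the circle (for `Nonempty`). [folklore] -/
def pt : Metric.sphere (0 : EuclideanSpace ℝ (Fin 2)) 1 :=
  ⟨EuclideanSpace.single 0 1, by simp⟩

/-- `𝕊¹ × ℝ³` is nonempty (for `Function.invFunOn`). [folklore] -/
instance : Nonempty ((Metric.sphere (0 : EuclideanSpace ℝ (Fin 2)) 1) × EuclideanSpace ℝ (Fin 3)) :=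
  ⟨(pt, 0)⟩

/-- **The inverse of the tube** `ν⁻¹ = invFunOn ν (𝕊¹ × B(0, ε))`. [folklore] -/
def νinv : X → (Metric.sphere (0 : EuclideanSpace ℝ (Fin 2)) 1) × EuclideanSpace ℝ (Fin 3) :=
  invFunOn D.ν (univ ×ˢ ball 0 D.ε)

/-- `ν⁻¹ (ν p) = p` on the tube. [folklore] -/
theorem νinv_ν {p : (Metric.sphere (0 : EuclideanSpace ℝ (Fin 2)) 1) × EuclideanSpace ℝ (Fin 3)}
    (hp : p ∈ univ ×ˢ ball (0 : EuclideanSpace ℝ (Fin 3)) D.ε) : D.νinv (D.ν p) = p :=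
  D.hinj.leftInvOn_invFunOn hp

/-- `ν (ν⁻¹ x) = x` on the image of the tube. [folklore] -/
theorem ν_νinv {x : X} (hx : x ∈ D.ν '' (univ ×ˢ ball 0 D.ε)) : D.ν (D.νinv x) = x :=
  invFunOn_eq (by obtain ⟨p, hp, rfl⟩ := hx; exact ⟨p, hp, rfl⟩)

/-- `ν⁻¹ x` lies in the tube for `x` in the image. [folklore] -/
theorem νinv_mem {x : X} (hx : x ∈ D.ν '' (univ ×ˢ ball 0 D.ε)) :
    D.νinv x ∈ univ ×ˢ ball (0 : EuclideanSpace ℝ (Fin 3)) D.ε :=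
  invFunOn_mem (by obtain ⟨p, hp, rfl⟩ := hx; exact ⟨p, hp, rfl⟩)

/-- **`ν⁻¹` is smooth on the (open) image of the tube** (inverse function theorem).
[cite: LeeSmoothManifolds2013, Thm. 4.5] -/
theorem contMDiffOn_νinv [T2Space X] :
    ContMDiffOn (𝓡 4) ((𝓡 1).prod 𝓘(ℝ, EuclideanSpace ℝ (Fin 3))) ∞ D.νinv (D.ν '' (univ ×ˢ ball 0 D.ε)) :=
  haveI : Fact (Module.finrank ℝ (EuclideanSpace ℝ (Fin 2)) = 1 + 1) := ⟨by simp⟩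
  Literature.Geometry.Manifold.contMDiffOn_invFunOn_of_bijective_mfderiv
    (isOpen_univ.prod isOpen_ball) D.hν D.hinj D.hbij

/-! ### The inverse of the global tube -/

section Inverse

variable [CompactSpace X]

/-- The flow time attached to a point: `τ(x) = ½ log λ(b - F x)`. [folklore] -/
def τ (x : X) : ℝ := 1 / 2 * Real.log (D.lam (D.b - D.F x))

/-- The flowed-back point `θ (-τ x, x)`. [folklore] -/
def back (x : X) : X := D.θ (-D.τ x, x)

/-- **The inverse of the global tube**: `Νinv x = (u, √λ(b - F x) • y')`,
`(u, y') = ν⁻¹ (θ (-τ x, x))`. [folklore] -/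
def Νinv (x : X) : (Metric.sphere (0 : EuclideanSpace ℝ (Fin 2)) 1) × EuclideanSpace ℝ (Fin 3) :=
  ((D.νinv (D.back x)).1, √(D.lam (D.b - D.F x)) • (D.νinv (D.back x)).2)

/-- `τ` is smooth. [folklore] -/
theorem contMDiff_τ : ContMDiff (𝓡 4) 𝓘(ℝ, ℝ) ∞ D.τ := by
  have h1 : ContMDiff (𝓡 4) 𝓘(ℝ, ℝ) ∞ fun x => D.lam (D.b - D.F x) :=
    D.contDiff_lam.comp_contMDiff (contMDiff_const.sub D.hF)
  have h2 : ContDiff ℝ ∞ fun s : ℝ => 1 / 2 * Real.log (D.lam s) :=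
    contDiff_const.mul (D.contDiff_lam.log fun s => (D.lam_pos s).ne')
  exact h2.comp_contMDiff (contMDiff_const.sub D.hF)

/-- `back` is smooth. [folklore] -/
theorem contMDiff_back : ContMDiff (𝓡 4) (𝓡 4) ∞ D.back :=
  D.hθ.comp (D.contMDiff_τ.neg.prodMk contMDiff_id)

/-- `exp (2 τ x) = λ(b - F x)`. [folklore] -/
theorem exp_two_mul_τ (x : X) : Real.exp (2 * D.τ x) = D.lam (D.b - D.F x) := by
  rw [τ, ← mul_assoc, show (2 : ℝ) * (1 / 2) = 1 by norm_num, one_mul, Real.exp_log (D.lam_pos _)]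

/-- `exp (2 (-τ x)) = (λ(b - F x))⁻¹`. [folklore] -/
theorem exp_two_mul_neg_τ (x : X) : Real.exp (2 * -D.τ x) = (D.lam (D.b - D.F x))⁻¹ := by
  rw [mul_neg, Real.exp_neg, D.exp_two_mul_τ]

omit [CompactSpace X] in
/-- `θ (-t, θ (t, x)) = x`. [folklore] -/
theorem θ_neg_θ (t : ℝ) (x : X) : D.θ (-t, D.θ (t, x)) = x := by
  rw [D.hθadd, neg_add_cancel, D.hθ0]

omit [CompactSpace X] in
/-- `θ (t, θ (-t, x)) = x`. [folklore] -/
theorem θ_θ_neg (t : ℝ) (x : X) : D.θ (t, D.θ (-t, x)) = x := by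
  rw [D.hθadd, add_neg_cancel, D.hθ0]

variable [T2Space X]

/-- **`Νinv` is a left inverse of `Ν` on `𝕊¹ × D³(√(b - a))`.** [folklore] -/
theorem Νinv_Ν {u : Metric.sphere (0 : EuclideanSpace ℝ (Fin 2)) 1} {y : EuclideanSpace ℝ (Fin 3)}
    (hy : ‖y‖ ≤ √(D.b - D.a)) : D.Νinv (D.Ν (u, y)) = (u, y) := by
  have hF : D.b - D.F (D.Ν (u, y)) = ‖y‖ ^ 2 := by rw [(D.apply_Ν hy).1]; ring
  have hτ : D.τ (D.Ν (u, y)) = D.time y := by rw [τ, hF]; rfl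
  have hback : D.back (D.Ν (u, y)) = D.ν (u, D.shrink y) := by
    rw [back, hτ]; exact D.θ_neg_θ _ _
  have hν : D.νinv (D.back (D.Ν (u, y))) = (u, D.shrink y) := by
    rw [hback]; exact D.νinv_ν (D.shrink_mem u y)
  rw [Νinv, hν, hF, D.sqrt_lam_smul_shrink]

/-- **The flowed-back point of a point of `V` lies in the tube**, with
`b - F (back x) = (b - F x) / λ(b - F x)` and `β (back x) = β x`. [folklore] -/
theorem back_spec {x : X} (hx : D.a ≤ D.F x) :
    D.back x ∈ D.ν '' (univ ×ˢ ball 0 D.ε) ∧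
      D.b - D.F (D.back x) = (D.b - D.F x) / D.lam (D.b - D.F x) ∧ D.β (D.back x) = D.β x := by
  by_cases hxe : x ∈ range D.e
  · obtain ⟨u, rfl⟩ := hxe
    have hτ : D.τ (D.e u) = 0 := by
      rw [τ, D.apply_e, sub_self, D.lam_of_le D.s₀_spec.1.le, Real.log_one, mul_zero]
    have hback : D.back (D.e u) = D.e u := by rw [back, hτ, neg_zero, D.hθ0]
    rw [hback, D.apply_e, sub_self, zero_div]
    exact ⟨⟨(u, 0), Set.mk_mem_prod (mem_univ u) (mem_ball_self D.hε), D.hν0 u⟩, rfl, rfl⟩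
  · have hs0 : 0 < D.b - D.F x := by linarith [D.apply_lt_of_not_mem hxe]
    have ht : (D.b - D.F x) * Real.exp (2 * -D.τ x) ≤ D.b - D.a := by
      rw [D.exp_two_mul_neg_τ, ← div_eq_mul_inv]
      exact (div_le_self hs0.le (D.one_le_lam _)).trans (by linarith)
    obtain ⟨h1, h2⟩ := D.flow_level hx hxe ht
    rw [D.exp_two_mul_neg_τ, ← div_eq_mul_inv] at h1
    have hFb : D.a ≤ D.F (D.back x) := by
      have := (div_le_self hs0.le (D.one_le_lam (D.b - D.F x))).trans (show D.b - D.F x ≤ D.b - D.a by linarith)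
      change D.b - D.F (D.back x) = _ at h1
      linarith
    have hgt : D.bound < D.F (D.back x) := by
      have := D.div_lam_le (D.b - D.F x)
      have := D.s₀_spec.2.2
      change D.b - D.F (D.back x) = _ at h1
      linarith
    exact ⟨D.mem_image_of_bound_lt hFb hgt, h1, h2⟩

/-- **`Νinv` is smooth at every point of `V = {a ≤ F}`.** [cite: LeeSmoothManifolds2013, Thm. 4.5] -/
theorem contMDiffAt_Νinv {x : X} (hx : D.a ≤ D.F x) :
    ContMDiffAt (𝓡 4) ((𝓡 1).prod 𝓘(ℝ, EuclideanSpace ℝ (Fin 3))) ∞ D.Νinv x := by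
  have g3 : ContMDiffAt (𝓡 4) ((𝓡 1).prod 𝓘(ℝ, EuclideanSpace ℝ (Fin 3))) ∞
      (fun z => D.νinv (D.back z)) x :=
    (D.contMDiffOn_νinv.contMDiffAt (D.hopen.mem_nhds (D.back_spec hx).1)).comp x (D.contMDiff_back x)
  have g4 : ContMDiffAt (𝓡 4) 𝓘(ℝ, ℝ) ∞ (fun z => √(D.lam (D.b - D.F z))) x := by
    have h : ContDiff ℝ ∞ fun s : ℝ => √(D.lam s) := D.contDiff_lam.sqrt fun s => (D.lam_pos s).ne'
    exact (h.comp_contMDiff (contMDiff_const.sub D.hF)) x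
  have g5 : ContMDiffAt (𝓡 4) 𝓘(ℝ, EuclideanSpace ℝ (Fin 3)) ∞
      (fun z => √(D.lam (D.b - D.F z)) • (D.νinv (D.back z)).2) x :=
    contDiff_smul.contDiffAt.comp_contMDiffAt (g4.prodMk_space (contMDiffAt_snd.comp x g3))
  exact (contMDiffAt_fst.comp x g3).prodMk g5

/-- **Every point of `V` is in the image of the global tube**: `x = Ν (u, y)` with
`‖y‖ ≤ √(b - a)`. [cite: Milnor1963, proof of Thm. 3.1] -/
theorem exists_Ν_eq {x : X} (hx : D.a ≤ D.F x) :
    ∃ (u : Metric.sphere (0 : EuclideanSpace ℝ (Fin 2)) 1) (y : EuclideanSpace ℝ (Fin 3)),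
      ‖y‖ ≤ √(D.b - D.a) ∧ D.Ν (u, y) = x := by
  obtain ⟨hmem, hF1, -⟩ := D.back_spec hx
  obtain ⟨⟨u, y₁⟩, hp, hx₁⟩ := hmem
  have hy₁ : ‖y₁‖ < D.ε := mem_ball_zero_iff.1 hp.2
  set s := D.b - D.F x with hs
  have hs0 : 0 ≤ s := by linarith [D.apply_le x]
  have hsle : s ≤ D.b - D.a := by simp only [hs]; linarith
  -- `‖y₁‖² = s / λ(s)`
  have hy₁sq : ‖y₁‖ ^ 2 = s / D.lam s := by
    have h := (D.hνF u y₁ hy₁).1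
    rw [hx₁] at h
    change D.b - D.F (D.back x) = _ at hF1
    linarith
  set y : EuclideanSpace ℝ (Fin 3) := √(D.lam s) • y₁ with hy
  have hysq : ‖y‖ ^ 2 = s := by
    rw [hy, norm_smul, mul_pow, Real.norm_eq_abs, sq_abs, Real.sq_sqrt (D.lam_pos s).le, hy₁sq,
      mul_div_cancel₀ _ (D.lam_pos s).ne']
  have hshrink : D.shrink y = y₁ := by
    rw [shrink, hysq, hy, smul_smul, inv_mul_cancel₀ (D.sqrt_lam_pos s).ne', one_smul]
  have htime : D.time y = D.τ x := by rw [time, hysq]; rfl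
  refine ⟨u, y, ?_, ?_⟩
  · rw [← Real.sqrt_sq (norm_nonneg y), hysq]
    exact Real.sqrt_le_sqrt hsle
  · rw [Ν]
    change D.θ (D.time y, D.ν (u, D.shrink y)) = x
    rw [hshrink, htime, hx₁, back]
    exact D.θ_θ_neg _ _

end Inverse

end Setup

end BottFlow

/-- **The global tube parametrisation of a Morse–Bott superlevel set** (flow layer of the fibred
Morse–Bott recognition `helper_sliceGluing_bottRecognition`).  Let `X` be a closed smooth
`4`-manifold, `F : X → ℝ` and `β : X → ℝ²` smooth, `a < b`, with `F ≤ b` on `V = {a ≤ F}` and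
the critical points of `F` in `V` exactly a circle `e(𝕊¹)`; let `ν : 𝕊¹ × ℝ³ → X` be a
Morse–Bott tube about it (smooth and injective on `𝕊¹ × B(0, ε)` with open image and bijective
differentials, `ν (u, 0) = e u`, `F (ν (u, y)) = b - ‖y‖²`, `β (ν (u, y)) = u`); and let `W` be a
smooth vector field vanishing on the circle with `dF(W) = 2 (F - b)` and `dβ(W) = 0` on `V`,
with global flow `θ` (jointly smooth, group laws, integral curves).  Then there are a smooth
`Ν : 𝕊¹ × ℝ³ → X` and `Νinv : X → 𝕊¹ × ℝ³` with `F (Ν (u, y)) = b - ‖y‖²`, `β (Ν (u, y)) = u`,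
`Νinv (Ν (u, y)) = (u, y)` for `‖y‖ ≤ √(b - a)`, every point of `V` of the form `Ν (u, y)` with
`‖y‖ ≤ √(b - a)`, and `Νinv` smooth at the points of `V` (Milnor's regular interval theorem,
*Morse theory* (1963), Thm. 3.1, run along the flow of `W` with the first integral `β` and glued
to the Morse–Bott tube: `Ν (u, y) = θ (½ log λ(‖y‖²), ν (u, y/√λ(‖y‖²)))`).
[cite: Milnor1963, Thm. 3.1] [cite: LeeSmoothManifolds2013, Thm. 9.12] -/
theorem helper_bott_flow : ∀ (X : Type) [TopologicalSpace X] [T2Space X] [CompactSpace X] [ChartedSpace (EuclideanSpace ℝ (Fin 4)) X] [IsManifold (𝓡 4) ∞ X] (F : X → ℝ) (β : X → EuclideanSpace ℝ (Fin 2)) (a b ε : ℝ) (e : Metric.sphere (0 : EuclideanSpace ℝ (Fin 2)) 1 → X) (ν : (Metric.sphere (0 : EuclideanSpace ℝ (Fin 2)) 1) × EuclideanSpace ℝ (Fin 3) → X) (W : Π x : X, TangentSpace (𝓡 4) x) (θ : ℝ × X → X), a < b → 0 < ε → ContMDiff (𝓡 4) 𝓘(ℝ, ℝ) ∞ F → ContMDiff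 (𝓡 4) 𝓘(ℝ, EuclideanSpace ℝ (Fin 2)) ∞ β → (∀ x, a ≤ F x → F x ≤ b) → (∀ x, a ≤ F x → (IsMCriticalPt (𝓡 4) F x ↔ x ∈ Set.range e)) → ContMDiffOn ((𝓡 1).prod 𝓘(ℝ, EuclideanSpace ℝ (Fin 3))) (𝓡 4) ∞ ν (Set.univ ×ˢ Metric.ball 0 ε) → Set.InjOn ν (Set.univ ×ˢ Metric.ball 0 ε) → IsOpen (ν '' (Set.univ ×ˢ Metric.ball 0 ε)) → (∀ p ∈ Set.univ ×ˢ Metric.ball (0 : EuclideanSpace ℝ (Fin 3)) ε, Function.Bijective (mfderiv ((𝓡 1).prod 𝓘(ℝ, EuclideanSpace ℝ (Fin 3))) (𝓡 4) ν p)) → (∀ u, ν (u, 0) = e u) → (∀ (u : Metric.sphere (0 : EuclideanSpace ℝ (Fin 2)) 1) (y : EuclideanSpace ℝ (Fin 3)), ‖y‖ < ε → F (ν (u, y)) = b - ‖y‖ ^ 2 ∧ β (ν (u, y)) = u) → ContMDiff (𝓡 4) (𝓡 4).tangent ∞ (fun x => (⟨x, W x⟩ : TangentBundle (𝓡 4)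 X)) → (∀ u, W (e u) = 0) → (∀ x, a ≤ F x → mfderiv (𝓡 4) 𝓘(ℝ, ℝ) F x (W x) = 2 * (F x - b) ∧ mfderiv (𝓡 4) 𝓘(ℝ, EuclideanSpace ℝ (Fin 2)) β x (W x) = 0) → ContMDiff (𝓘(ℝ, ℝ).prod (𝓡 4)) (𝓡 4) ∞ θ → (∀ p, θ (0, p) = p) → (∀ t s p, θ (t, θ (s, p)) = θ (t + s, p)) → (∀ p, IsMIntegralCurve (fun t => θ (t, p)) W) → ∃ (Ν : (Metric.sphere (0 : EuclideanSpace ℝ (Fin 2)) 1) × EuclideanSpace ℝ (Fin 3) → X) (Νinv : X → (Metric.sphere (0 : EuclideanSpace ℝ (Fin 2)) 1) × EuclideanSpace ℝ (Fin 3)), ContMDiff ((𝓡 1).prod 𝓘(ℝ, EuclideanSpace ℝ (Fin 3))) (𝓡 4) ∞ Ν ∧ (∀ (u : Metric.sphere (0 : EuclideanSpace ℝ (Fin 2)) 1) (y : EuclideanSpace ℝ (Fin 3)), ‖y‖ ≤ √(b - a) → F (Ν (u, y)) = b - ‖y‖ ^ 2 ∧ β (Ν (u, y)) = (u : EuclideanSpace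 ℝ (Fin 2)) ∧ Νinv (Ν (u, y)) = (u, y)) ∧ (∀ x, a ≤ F x → ContMDiffAt (𝓡 4) ((𝓡 1).prod 𝓘(ℝ, EuclideanSpace ℝ (Fin 3))) ∞ Νinv x ∧ ∃ (u : Metric.sphere (0 : EuclideanSpace ℝ (Fin 2)) 1) (y : EuclideanSpace ℝ (Fin 3)), ‖y‖ ≤ √(b - a) ∧ Ν (u, y) = x) := by
  intro X _ _ _ _ _ F β a b ε e ν W θ hab hε hF hβ hFle hcrit hν hinj hopen hbij hν0 hνF hW hW0 hcons hθ hθ0 hθadd hθint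
  let D : BottFlow.Setup X :=
    { F := F, β := β, a := a, b := b, ε := ε, e := e, ν := ν, W := W, θ := θ, hab := hab, hε := hε,
      hF := hF, hβ := hβ, hFle := hFle, hcrit := hcrit, hν := hν, hinj := hinj, hopen := hopen,
      hbij := hbij, hν0 := hν0, hνF := hνF, hW := hW, hW0 := hW0, hcons := hcons, hθ := hθ,
      hθ0 := hθ0, hθadd := hθadd, hθint := hθint }
  refine ⟨D.Ν, D.Νinv, D.contMDiff_Ν, fun u y hy => ⟨(D.apply_Ν hy).1, (D.apply_Ν hy).2, D.Νinv_Ν hy⟩,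
    fun x hx => ⟨D.contMDiffAt_Νinv hx, D.exists_Ν_eq hx⟩⟩

end Summit.SmoothPoincare4.SmoothPoincare4.Cruxes.RungOne.Sketch

end
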